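import Summits.Ventures.Crystal3D.Theorems.StickyWulffConstantCoaxialWallLawVicinalDeepSplit
import Summits.Ventures.Crystal3D.Theorems.StickyWulffConstantCoaxialWallLawChainTorsionWide
import Summits.Ventures.Crystal3D.Theorems.StickyWulffConstantCoaxialWallLawMenuFrames
import HarnessLib

/-!
# The REACH core: registered for EVERY admissible walker vertical (crux `CoaxialWallLaw`, stmt-Ventures-19481, line `WallLedgerF`)

HONEST FRAMING. Venture `Summits/Ventures/Crystal3D` (cell `crystal3d-full`), helper `--supports` the crux `CoaxialWallLaw`
of `route-Ventures-StickyWulffConstant` (REGISTERED line `WallLedgerF`, open stub `stub_coaxialTwoSlabAdhesion`).  Book-keeping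
by theorem on top of `…VicinalDeepSplit`; rung credit; F-C1 not moved; NOT the crux; `ExactOnly`(C12-55) / `StarPairFar` BY NAME.

The vicinal core's registry hypothesis (iii) is the LEVEL-⅓ shadow of the one-sided positional ledger
`twoSlabLedgerAt_oneSided_reach_wide` (19481-p1 g10, 19480-p1/p2): grain 1 alone pays `½κ₁` whenever its reach set over the
forced chains `chainFrames z′ A₁ u` of ANY admissible walker vertical `z′` (`‖z′ − e₃‖ ≤ 1/3`, `u` steep for `z′`) misses the
far affine lattice.  This file folds the ledger in at full strength (every vertical, every level):

* `coaxialTwoSlabAdhesion_of_offReach` — admissible `(z′, u)`, an admissible axis `m` dominated by `u`, reach set missing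
  `A₂·Λ₀ + t₂` ⇒ the stub's conclusion VERBATIM (frame `L e₃ = m`);
* **`ReachPair`** `:= VicinalPair ∧ [∀ admissible (z′, u, m) with u dominating m: SOME point of the reach set lies in A₂·Λ₀ + t₂]`;
  `CoaxialTwoSlabAdhesionReach := On ReachPair`; **`coaxialTwoSlabAdhesion_of_reach`**: {E1, `StarPairFar`, reach core} ⇒ stub;
* the split transfers (`ReachPair → VicinalPair`): debts **`…ReachCoherentTwin`**, **`…ReachCoherentFault`**,
  **`…ReachIncoherentDeep`** and `coaxialTwoSlabAdhesion_of_reachSplit`.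
READING (numerics of record, kit j313441: 320 Haar wall normals × 32 admissible verticals, exact one-sided registries): the
reach-registered translation classes are `{0}` (53 %), `{0, ±b_basal}` (44 %), and for 2.8 % of normals six extra classes of
level 1/9 (one cyclic tower; nothing of level 1/27) — so `…ReachIncoherentDeep` is a sliver and lane F's debt is, in
substance, the two census objects (vicinal coherent twins, vicinal basal faults).
WHAT THIS IS NOT: a proof of any debt; F-C1 not moved.
-/

noncomputable section

namespace Summit.Ventures.Crystal3D.Theorems

open Summit.Ventures.Crystal3D Finset
open Summit.Ventures.Crystal3D.Cruxes.CoaxialWallLaw.WallLedgerF (CoaxialTwoSlabAdhesion)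
open Literature.MathematicalPhysics.StatisticalMechanics (fccStacking barlowStacking IsHaggSeq contactDeficiency
  isHaggSeq_const)
open scoped InnerProductSpace

open scoped Classical in
/-- **Off-reach for one admissible vertical, stub-shaped.**  Admissible `(z′, u)` (`‖z′‖ = 1`, `‖z′ − e₃‖ ≤ 1/3`, `u` steep
for `z′`), an admissible axis `m` of the pair dominated by `u` (`√(1 − ⟪m,e₃⟫²) ≤ √2·⟪A₁u, e₃⟫`), and grain 1's reach set over
`chainFrames z′ A₁ u` missing `A₂·Λ₀ + t₂` ⇒ the conclusion of `stub_coaxialTwoSlabAdhesion`, arbitrary fillings, modulo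
`ExactOnly`(C12-55) and `StarPairFar`. -/
theorem coaxialTwoSlabAdhesion_of_offReach
    {s₀ : EuclideanSpace ℝ (Fin 3)} (hs₀ : s₀ ∈ fccSlots)
    (hcert : ExactOnly 0 (fccSlots.filter fun w => 0 < ⟪w, s₀⟫_ℝ)) (hSP : StarPairFar)
    (A₁ : EuclideanSpace ℝ (Fin 3) ≃ₗᵢ[ℝ] EuclideanSpace ℝ (Fin 3)) (t₁ : EuclideanSpace ℝ (Fin 3))
    (A₂ : EuclideanSpace ℝ (Fin 3) ≃ₗᵢ[ℝ] EuclideanSpace ℝ (Fin 3)) (t₂ : EuclideanSpace ℝ (Fin 3))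
    {z : EuclideanSpace ℝ (Fin 3)} (hz : ‖z‖ = 1) (hze : ‖z - EuclideanSpace.single (2 : Fin 3) (1 : ℝ)‖ ≤ 1 / 3)
    {u : EuclideanSpace ℝ (Fin 3)} (hu : u ∈ fccSlots) (hsteep : Real.sqrt 2 / 2 ≤ ⟪A₁ u, z⟫_ℝ)
    {m : EuclideanSpace ℝ (Fin 3)} (hm : ‖m‖ = 1)
    (hmenum : ∀ w ∈ fccSlots, ⟪A₁ w, m⟫_ℝ = 0 ∨ ⟪A₁ w, m⟫_ℝ = Real.sqrt (2 / 3) ∨ ⟪A₁ w, m⟫_ℝ = -Real.sqrt (2 / 3))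
    (hadm : A₂ '' fccStacking 1 (Real.sqrt (2 / 3)) = A₁ '' fccStacking 1 (Real.sqrt (2 / 3)) ∨
      A₂ '' fccStacking 1 (Real.sqrt (2 / 3)) = twinFrame A₁ m '' fccStacking 1 (Real.sqrt (2 / 3)))
    (hdom : Real.sqrt (1 - ⟪m, EuclideanSpace.single (2 : Fin 3) (1 : ℝ)⟫_ℝ ^ 2) ≤
      Real.sqrt 2 * ⟪A₁ u, EuclideanSpace.single (2 : Fin 3) (1 : ℝ)⟫_ℝ)
    (hoff : ∀ y ∈ reachSet A₁ t₁ (chainFrames z A₁ u), y ∉ (fun q => A₂ q + t₂) '' fccStacking 1 (Real.sqrt (2 / 3))) :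
    ∃ (L : EuclideanSpace ℝ (Fin 3) ≃ₗᵢ[ℝ] EuclideanSpace ℝ (Fin 3))
        (s₁ s₂ : EuclideanSpace ℝ (Fin 3)) (σ σ' : ℤ → ℤ), IsHaggSeq σ ∧ IsHaggSeq σ' ∧
        (fun p => A₁ p + t₁) '' fccStacking 1 (Real.sqrt (2 / 3)) ⊆
          (fun p => L p + s₁) '' barlowStacking 1 (Real.sqrt (2 / 3)) σ ∧
        (fun p => A₂ p + t₂) '' fccStacking 1 (Real.sqrt (2 / 3)) ⊆
          (fun p => L p + s₂) '' barlowStacking 1 (Real.sqrt (2 / 3)) σ' ∧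
    ∃ C R₀ : ℝ, 1 ≤ R₀ ∧ ∀ h : ℝ, 0 ≤ h → ∀ ρ : ℝ, R₀ ≤ ρ →
      ∀ X P₁ P₂ : Finset (EuclideanSpace ℝ (Fin 3)),
      (∀ p ∈ X, ∀ q ∈ X, p ≠ q → 1 ≤ dist p q) → P₁ ⊆ X → P₂ ⊆ X \ P₁ →
      (∀ p ∈ X, -(2 * R₀) ≤ p 2 ∧ p 2 ≤ h + 2 * R₀ ∧ p 0 ^ 2 + p 1 ^ 2 ≤ ρ ^ 2) →
      (∀ p, p ∈ P₁ ↔ (p ∈ (fun q => A₁ q + t₁) '' fccStacking 1 (Real.sqrt (2 / 3)) ∧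
        -(2 * R₀) ≤ p 2 ∧ p 2 ≤ -R₀ ∧ p 0 ^ 2 + p 1 ^ 2 ≤ ρ ^ 2)) →
      (∀ p, p ∈ P₂ ↔ (p ∈ (fun q => A₂ q + t₂) '' fccStacking 1 (Real.sqrt (2 / 3)) ∧
        h + R₀ ≤ p 2 ∧ p 2 ≤ h + 2 * R₀ ∧ p 0 ^ 2 + p 1 ^ 2 ≤ ρ ^ 2)) →
      ((((P₁ ×ˢ (X \ P₁)).filter fun pq => dist pq.1 pq.2 = 1).card : ℕ) : ℝ) +
        ((((P₂ ×ˢ ((X \ P₁) \ P₂)).filter fun pq => dist pq.1 pq.2 = 1).card : ℕ) : ℝ) ≤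
        contactDeficiency ((X \ P₁) \ P₂) +
          (Real.sqrt 2 / 4 * ∑ᶠ w ∈ {w ∈ fccStacking 1 (Real.sqrt (2 / 3)) | ‖w‖ = 1},
              |⟪w, A₁.symm (EuclideanSpace.single (2 : Fin 3) (1 : ℝ))⟫_ℝ| +
            Real.sqrt 2 / 4 * ∑ᶠ w ∈ {w ∈ fccStacking 1 (Real.sqrt (2 / 3)) | ‖w‖ = 1},
              |⟪w, A₂.symm (EuclideanSpace.single (2 : Fin 3) (1 : ℝ))⟫_ℝ| -
            (1 / 2 : ℝ) * Real.sqrt (1 - ⟪L (EuclideanSpace.single (2 : Fin 3) (1 : ℝ)),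
              (EuclideanSpace.single (2 : Fin 3) (1 : ℝ))⟫_ℝ ^ 2)) * Real.pi * ρ ^ 2 +
          C * (1 + h) * ρ := by
  have hcell := twoSlabLedgerAt_oneSided_reach_wide hs₀ hcert hSP A₁ t₁ A₂ t₂ hz hze hu hsteep hoff
  obtain ⟨L, hLΛ, hLe⟩ := exists_frame_of_menu A₁ hm hmenum
  have hsub₁ := movedFcc_subset_frame hLΛ t₁
  have hq : (1 / 2 : ℝ) * Real.sqrt (1 - ⟪L (EuclideanSpace.single (2 : Fin 3) (1 : ℝ)),
      (EuclideanSpace.single (2 : Fin 3) (1 : ℝ))⟫_ℝ ^ 2) ≤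
      Real.sqrt 2 * |⟪A₁ u, EuclideanSpace.single (2 : Fin 3) (1 : ℝ)⟫_ℝ| / 2 := by
    rw [hLe]
    have := le_abs_self ⟪A₁ u, EuclideanSpace.single (2 : Fin 3) (1 : ℝ)⟫_ℝ
    have h2 : 0 ≤ Real.sqrt 2 := Real.sqrt_nonneg 2
    nlinarith [hdom, mul_le_mul_of_nonneg_left this h2]
  rcases hadm with hadm | hadm
  · exact coaxialStub_of_twoSlabLedgerAt_frame hcell L t₁ t₂ isHaggSeq_const isHaggSeq_const hsub₁
      (movedFcc_subset_frame (hLΛ.trans hadm.symm) t₂) hq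
  · exact coaxialStub_of_twoSlabLedgerAt_frame hcell L t₁ t₂ isHaggSeq_const isHaggSeq_negConst hsub₁
      (movedFcc_subset_frame_negConst (twin_image_eq_frame_negConst hm hLΛ hLe hadm) t₂) hq

/-- **The reach pair predicate**: a vicinal pair that is moreover REGISTERED for every admissible walker vertical — for every
unit `z′` with `‖z′ − e₃‖ ≤ 1/3`, every slot `u` steep for `z′`, and every admissible axis `m` dominated by `u`, some point of grain
1's reach set over `chainFrames z′ A₁ u` lies in `A₂·Λ₀ + t₂`. -/
def ReachPair : CoaxialPairPred := fun A₁ t₁ A₂ t₂ =>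
  VicinalPair A₁ t₁ A₂ t₂ ∧
    ∀ z : EuclideanSpace ℝ (Fin 3), ‖z‖ = 1 → ‖z - EuclideanSpace.single (2 : Fin 3) (1 : ℝ)‖ ≤ 1 / 3 →
    ∀ u ∈ fccSlots, Real.sqrt 2 / 2 ≤ ⟪A₁ u, z⟫_ℝ →
    ∀ m : EuclideanSpace ℝ (Fin 3), ‖m‖ = 1 →
    (∀ w ∈ fccSlots, ⟪A₁ w, m⟫_ℝ = 0 ∨ ⟪A₁ w, m⟫_ℝ = Real.sqrt (2 / 3) ∨ ⟪A₁ w, m⟫_ℝ = -Real.sqrt (2 / 3)) →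
    (A₂ '' fccStacking 1 (Real.sqrt (2 / 3)) = A₁ '' fccStacking 1 (Real.sqrt (2 / 3)) ∨
      A₂ '' fccStacking 1 (Real.sqrt (2 / 3)) = twinFrame A₁ m '' fccStacking 1 (Real.sqrt (2 / 3))) →
    Real.sqrt (1 - ⟪m, EuclideanSpace.single (2 : Fin 3) (1 : ℝ)⟫_ℝ ^ 2) ≤
      Real.sqrt 2 * ⟪A₁ u, EuclideanSpace.single (2 : Fin 3) (1 : ℝ)⟫_ℝ →
    ∃ y ∈ reachSet A₁ t₁ (chainFrames z A₁ u), y ∈ (fun q => A₂ q + t₂) '' fccStacking 1 (Real.sqrt (2 / 3))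

/-- **The REACH core**: the stub restricted to reach pairs. -/
def CoaxialTwoSlabAdhesionReach : Prop := CoaxialTwoSlabAdhesionOn ReachPair

/-- Nothing is smuggled. -/
theorem coaxialTwoSlabAdhesionReach_of_stub (h : CoaxialTwoSlabAdhesion) : CoaxialTwoSlabAdhesionReach :=
  coaxialTwoSlabAdhesionOn_of_stub _ h

/-- The reach core is implied by the vicinal core (it is the smaller debt). -/
theorem coaxialTwoSlabAdhesionReach_of_vicinal (h : CoaxialTwoSlabAdhesionVicinal) : CoaxialTwoSlabAdhesionReach :=
  coaxialTwoSlabAdhesionOn_mono (fun _ _ _ _ hT => hT.1) (coaxialTwoSlabAdhesionVicinal_iff_on.1 h)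

open scoped Classical in
/-- **The registered stub IN FULL from E1, `StarPairFar` and the reach core.** -/
theorem coaxialTwoSlabAdhesion_of_reach
    {s₀ : EuclideanSpace ℝ (Fin 3)} (hs₀ : s₀ ∈ fccSlots)
    (hcert : ExactOnly 0 (fccSlots.filter fun w => 0 < ⟪w, s₀⟫_ℝ)) (hSP : StarPairFar)
    (hcore : CoaxialTwoSlabAdhesionReach) : CoaxialTwoSlabAdhesion := by
  -- reduce to the vicinal core with the extra registry clause discharged by `…_of_offReach`
  apply coaxialTwoSlabAdhesion_of_vicinal hs₀ hcert hSP
  rw [coaxialTwoSlabAdhesionVicinal_iff_on]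
  intro A₁ t₁ A₂ t₂ hco hne hV
  by_cases hR : ∀ z : EuclideanSpace ℝ (Fin 3), ‖z‖ = 1 → ‖z - EuclideanSpace.single (2 : Fin 3) (1 : ℝ)‖ ≤ 1 / 3 →
    ∀ u ∈ fccSlots, Real.sqrt 2 / 2 ≤ ⟪A₁ u, z⟫_ℝ →
    ∀ m : EuclideanSpace ℝ (Fin 3), ‖m‖ = 1 →
    (∀ w ∈ fccSlots, ⟪A₁ w, m⟫_ℝ = 0 ∨ ⟪A₁ w, m⟫_ℝ = Real.sqrt (2 / 3) ∨ ⟪A₁ w, m⟫_ℝ = -Real.sqrt (2 / 3)) →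
    (A₂ '' fccStacking 1 (Real.sqrt (2 / 3)) = A₁ '' fccStacking 1 (Real.sqrt (2 / 3)) ∨
      A₂ '' fccStacking 1 (Real.sqrt (2 / 3)) = twinFrame A₁ m '' fccStacking 1 (Real.sqrt (2 / 3))) →
    Real.sqrt (1 - ⟪m, EuclideanSpace.single (2 : Fin 3) (1 : ℝ)⟫_ℝ ^ 2) ≤
      Real.sqrt 2 * ⟪A₁ u, EuclideanSpace.single (2 : Fin 3) (1 : ℝ)⟫_ℝ →
    ∃ y ∈ reachSet A₁ t₁ (chainFrames z A₁ u), y ∈ (fun q => A₂ q + t₂) '' fccStacking 1 (Real.sqrt (2 / 3))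
  · exact hcore A₁ t₁ A₂ t₂ hco hne ⟨hV, hR⟩
  push Not at hR
  obtain ⟨z, hz, hze, u, hu, hsteep, m, hm, hmenum, hadm, hdom, hoff⟩ := hR
  exact coaxialTwoSlabAdhesion_of_offReach hs₀ hcert hSP A₁ t₁ A₂ t₂ hz hze hu hsteep hm hmenum hadm hdom hoff

/-! ### The split of the reach core -/

/-- **Debt R1 — reach-registered COHERENT TWINS** (vicinal; census twin rows). -/
def CoaxialTwoSlabAdhesionReachCoherentTwin : Prop :=
  CoaxialTwoSlabAdhesionOn fun A₁ t₁ A₂ t₂ => ReachPair A₁ t₁ A₂ t₂ ∧ CoherentTwinPair A₁ t₁ A₂ t₂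

/-- **Debt R2 — reach-registered COHERENT FAULTS** (vicinal basal stacking-fault staircases; census translation rows). -/
def CoaxialTwoSlabAdhesionReachCoherentFault : Prop :=
  CoaxialTwoSlabAdhesionOn fun A₁ t₁ A₂ t₂ =>
    (ReachPair A₁ t₁ A₂ t₂ ∧ ¬ CoherentTwinPair A₁ t₁ A₂ t₂) ∧ CoherentFaultPair A₁ t₁ A₂ t₂

/-- **Debt R3 — reach-registered DEEP INCOHERENT pairs** (offsets of level `3^{-j}`, `j ≥ 2`, registered for every admissible
walker vertical: numerically 2.8 % of wall normals × six level-1/9 classes). -/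
def CoaxialTwoSlabAdhesionReachIncoherentDeep : Prop :=
  CoaxialTwoSlabAdhesionOn fun A₁ t₁ A₂ t₂ =>
    ((ReachPair A₁ t₁ A₂ t₂ ∧ ¬ CoherentTwinPair A₁ t₁ A₂ t₂) ∧ ¬ CoherentFaultPair A₁ t₁ A₂ t₂) ∧ DeepPair A₁ t₁ A₂ t₂

/-- **Re-assembly**: the three reach debts give the reach core. -/
theorem coaxialTwoSlabAdhesionReach_of_split (h₁ : CoaxialTwoSlabAdhesionReachCoherentTwin)
    (h₂ : CoaxialTwoSlabAdhesionReachCoherentFault) (h₃ : CoaxialTwoSlabAdhesionReachIncoherentDeep) :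
    CoaxialTwoSlabAdhesionReach := by
  refine coaxialTwoSlabAdhesionOn_split CoherentTwinPair h₁ (coaxialTwoSlabAdhesionOn_split CoherentFaultPair h₂ ?_)
  intro A₁ t₁ A₂ t₂ hco hne hS
  exact h₃ A₁ t₁ A₂ t₂ hco hne ⟨hS, deepPair_of_incoherent A₁ t₁ A₂ t₂ hco hS.1.1.1 hS.1.2 hS.2⟩

/-- Nothing is smuggled: each reach debt is implied by the reach core. -/
theorem split_of_coaxialTwoSlabAdhesionReach (h : CoaxialTwoSlabAdhesionReach) :
    CoaxialTwoSlabAdhesionReachCoherentTwin ∧ CoaxialTwoSlabAdhesionReachCoherentFault ∧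
      CoaxialTwoSlabAdhesionReachIncoherentDeep :=
  ⟨coaxialTwoSlabAdhesionOn_mono (fun _ _ _ _ hT => hT.1) h,
    coaxialTwoSlabAdhesionOn_mono (fun _ _ _ _ hT => hT.1.1) h,
    coaxialTwoSlabAdhesionOn_mono (fun _ _ _ _ hT => hT.1.1.1) h⟩

/-- The reach debts are implied by the corresponding vicinal debts (they are the smaller debts). -/
theorem reachDebts_of_vicinalDebts (h₁ : CoaxialTwoSlabAdhesionCoherentTwin) (h₂ : CoaxialTwoSlabAdhesionCoherentFault)
    (h₃ : CoaxialTwoSlabAdhesionIncoherentDeep) :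
    CoaxialTwoSlabAdhesionReachCoherentTwin ∧ CoaxialTwoSlabAdhesionReachCoherentFault ∧
      CoaxialTwoSlabAdhesionReachIncoherentDeep :=
  ⟨coaxialTwoSlabAdhesionOn_mono (fun _ _ _ _ hT => ⟨hT.1.1, hT.2⟩) h₁,
    coaxialTwoSlabAdhesionOn_mono (fun _ _ _ _ hT => ⟨⟨hT.1.1.1, hT.1.2⟩, hT.2⟩) h₂,
    coaxialTwoSlabAdhesionOn_mono (fun _ _ _ _ hT => ⟨⟨⟨hT.1.1.1.1, hT.1.1.2⟩, hT.1.2⟩, hT.2⟩) h₃⟩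

open scoped Classical in
/-- **The registered stub IN FULL from E1, `StarPairFar` and the three reach debts.** -/
theorem coaxialTwoSlabAdhesion_of_reachSplit
    {s₀ : EuclideanSpace ℝ (Fin 3)} (hs₀ : s₀ ∈ fccSlots)
    (hcert : ExactOnly 0 (fccSlots.filter fun w => 0 < ⟪w, s₀⟫_ℝ)) (hSP : StarPairFar)
    (h₁ : CoaxialTwoSlabAdhesionReachCoherentTwin) (h₂ : CoaxialTwoSlabAdhesionReachCoherentFault)
    (h₃ : CoaxialTwoSlabAdhesionReachIncoherentDeep) : CoaxialTwoSlabAdhesion :=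
  coaxialTwoSlabAdhesion_of_reach hs₀ hcert hSP (coaxialTwoSlabAdhesionReach_of_split h₁ h₂ h₃)

end Summit.Ventures.Crystal3D.Theorems

end
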